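import Summits.QuantumFields.YangMills.Theorems.BalabanUVNodesN15KingModelMasslessReflectionPositivity
import Summits.QuantumFields.YangMills.Theorems.BalabanUVNodesN15KingModelMasslessFieldScaling
import Literature.NumberTheory.Sieve.BombieriAsymptoticSieveMertens

/-!
# BalabanUVNodes ∕ N15 — THE KING-MODEL RUNG (PART Ϻ-bb): CLUSTERING OF THE MASSLESS BLOCK FIELD AT THE CANONICAL RATE — `|Cov_{μ⁰_∞}(e^{φ(f)}, e^{φ(T_vg)})| ≤ e^{V_f∕2}e^{V_g∕2}|C_v|e^{|C_v|}`
# with the cross form `|C_v| ≤ (Σ|c_j||c′_k|)·Γ((d−1)∕2)∕(4π^{(d+1)∕2}R^{d−1})` once all inter-block gaps are `≥ R`, and MIXING `Cov → 0` along the translations `v → ∞`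
# (`d + 1 ≥ 3`; Track A, DAG node N15 = NE2; FAN-OUT v1.1 §N15 s3 «KING-MODEL RUNG»; count-neutral)

HONEST FRAMING.  Count-neutral (cell `pub-ymgap`, seat `pub-ymgap-dag-n15-e` g35; `--supports stmt-QuantumFields-27366 --as helper` = K3⁸).  King's `A = 0`, `g = 0` model
([King1986] C. King, Commun. Math. Phys. **102** (1986) 649–677).  The massless block field `μ⁰_∞` (parts Ϻ-x∕z∕aa) has no mass gap: its two-point function decays only like
`R^{−(d−1)}`.  Typed here, mirroring part Ϻ-q at zero mass: ★★ the joint exponential moment `∫e^{φ(f)}e^{φ(g)}dμ⁰_∞ = exp(V_f∕2 + V_g∕2 + C)`, the covariance identity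
`Cov = e^{V_f∕2}e^{V_g∕2}(e^{C} − 1)` and the bound `|Cov| ≤ e^{V_f∕2}e^{V_g∕2}|C|e^{|C|}`; ★★ the cross form under a translation `v` obeys `|C_v| ≤ Σ_{j,k}|c_j||c′_k|S₂^{0}(p′_k + v − p_j)`, hence
★★★ the POWER-LAW CLUSTERING `|C_v| ≤ (Σ|c_j||c′_k|)·Γ((d−1)∕2)∕(4π^{(d+1)∕2}R^{d−1})` whenever every gap `R₋(p′_k + v − p_j) ≥ R > 0`, and ★★ MIXING: `C_v → 0` and
`∫e^{φ(f)}e^{φ(T_vg)}dμ⁰_∞ → ∫e^{φ(f)}dμ⁰_∞∫e^{φ(g)}dμ⁰_∞` along the cofinite filter of translations.  NOT Bałaban's objects; NOT a node discharge; nothing continuum-Yang–Mills ∕ `ℝ⁴` ∕ OS ∕ Clay.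
0 `sorry`, 0 def; standard axioms.

WHAT THIS FILE PROVES (kernel).  §1 ★★ `integral_exp_mul_exp_fieldSum0`, ★ `cov_exp_fieldSum0_eq`, ★ `abs_cov_exp_fieldSum0_le`.  §2 `abs_crossForm0_le`, ★★★ **`abs_crossForm0_le_powerLaw`**,
★★ **`abs_cov_exp_shift0_le`**.  §3 `tendsto_crossForm0_cofinite`, ★★ **`tendsto_cov_exp_shift0`** (mixing of `μ⁰_∞`).

HONEST SCOPE.  King's free massless block field at infinite volume, `d + 1 ≥ 3`; exponential observables only.  N15 untouched; counts unmoved.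
Locators (use): [King1986] Thm 2.1 (2.22) p.654, Thm 3.3 (3.6) p.655.
-/

noncomputable section

open scoped BigOperators Topology
open Filter MeasureTheory ProbabilityTheory Finset

namespace Summit.QuantumFields.YangMills.BalabanUVNodes.N15KingModelRung.InfiniteVolume

open Summit.QuantumFields.YangMills.BalabanUVNodes.N15KingModelRung.OptimalDecay
open Summit.QuantumFields.YangMills.BalabanUVNodes.N15KingModelRung.ProperTime

variable {d : ℕ} {J J' : Type*}

/-! ## §1 Joint exponential moments and the covariance identity under `μ⁰_∞` -/

/-- ★★ `∫e^{Σc_jφ(p_j)}e^{Σc′_kφ(p′_k)}dμ⁰_∞ = exp(V∕2 + V′∕2 + C)`, `C = Σ_{j,k}c_jc′_kS₂^{0}(p′_k − p_j)` (`d ≥ 2`). [folklore] -/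
theorem integral_exp_mul_exp_fieldSum0 (hd : 2 ≤ d) (T : Finset J) (p : J → Fin (d + 1) → ℤ) (c : J → ℝ) (T' : Finset J') (p' : J' → Fin (d + 1) → ℤ) (c' : J' → ℝ) :
    ∫ ω, Real.exp (∑ j ∈ T, c j * ω (p j)) * Real.exp (∑ j ∈ T', c' j * ω (p' j)) ∂kingFieldInf0 d
      = Real.exp ((∑ j ∈ T, ∑ k ∈ T, c j * c k * kingS2Inf0 (p k - p j)) / 2 + (∑ j ∈ T', ∑ k ∈ T', c' j * c' k * kingS2Inf0 (p' k - p' j)) / 2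
          + ∑ j ∈ T, ∑ k ∈ T', c j * c' k * kingS2Inf0 (p' k - p j)) := by
  have hfun : (fun ω : (Fin (d + 1) → ℤ) → ℝ => Real.exp (∑ j ∈ T, c j * ω (p j)) * Real.exp (∑ j ∈ T', c' j * ω (p' j)))
      = fun ω => Real.exp (∑ q ∈ T.disjSum T', Sum.elim c c' q * ω (Sum.elim p p' q)) := by
    funext ω
    rw [← Real.exp_add, Finset.sum_disjSum]
    simp
  rw [hfun, integral_exp_fieldSum0 hd]
  congr 1
  rw [Finset.sum_disjSum]
  simp only [Finset.sum_disjSum, Sum.elim_inl, Sum.elim_inr, Finset.sum_add_distrib]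
  have hcross : ∑ j ∈ T', ∑ k ∈ T, c' j * c k * kingS2Inf0 (p k - p' j) = ∑ j ∈ T, ∑ k ∈ T', c j * c' k * kingS2Inf0 (p' k - p j) := by
    rw [Finset.sum_comm]
    refine Finset.sum_congr rfl fun j _ => Finset.sum_congr rfl fun k _ => ?_
    rw [← kingS2Inf0_neg (p' k - p j), neg_sub]
    ring
  rw [hcross]
  ring

/-- ★ The covariance identity: `∫e^{φ(f)}e^{φ(g)}dμ⁰_∞ − ∫e^{φ(f)}∫e^{φ(g)} = e^{V∕2}e^{V′∕2}(e^{C} − 1)`. [folklore] -/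
theorem cov_exp_fieldSum0_eq (hd : 2 ≤ d) (T : Finset J) (p : J → Fin (d + 1) → ℤ) (c : J → ℝ) (T' : Finset J') (p' : J' → Fin (d + 1) → ℤ) (c' : J' → ℝ) :
    (∫ ω, Real.exp (∑ j ∈ T, c j * ω (p j)) * Real.exp (∑ j ∈ T', c' j * ω (p' j)) ∂kingFieldInf0 d)
      - (∫ ω, Real.exp (∑ j ∈ T, c j * ω (p j)) ∂kingFieldInf0 d) * (∫ ω, Real.exp (∑ j ∈ T', c' j * ω (p' j)) ∂kingFieldInf0 d)
      = Real.exp ((∑ j ∈ T, ∑ k ∈ T, c j * c k * kingS2Inf0 (p k - p j)) / 2) * Real.exp ((∑ j ∈ T', ∑ k ∈ T', c' j * c' k * kingS2Inf0 (p' k - p' j)) / 2)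
        * (Real.exp (∑ j ∈ T, ∑ k ∈ T', c j * c' k * kingS2Inf0 (p' k - p j)) - 1) := by
  rw [integral_exp_mul_exp_fieldSum0 hd, integral_exp_fieldSum0 hd, integral_exp_fieldSum0 hd, Real.exp_add, Real.exp_add]
  ring

/-- ★ `|Cov| ≤ e^{V∕2}e^{V′∕2}|C|e^{|C|}`. [folklore] -/
theorem abs_cov_exp_fieldSum0_le (hd : 2 ≤ d) (T : Finset J) (p : J → Fin (d + 1) → ℤ) (c : J → ℝ) (T' : Finset J') (p' : J' → Fin (d + 1) → ℤ) (c' : J' → ℝ) :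
    |(∫ ω, Real.exp (∑ j ∈ T, c j * ω (p j)) * Real.exp (∑ j ∈ T', c' j * ω (p' j)) ∂kingFieldInf0 d)
        - (∫ ω, Real.exp (∑ j ∈ T, c j * ω (p j)) ∂kingFieldInf0 d) * (∫ ω, Real.exp (∑ j ∈ T', c' j * ω (p' j)) ∂kingFieldInf0 d)|
      ≤ Real.exp ((∑ j ∈ T, ∑ k ∈ T, c j * c k * kingS2Inf0 (p k - p j)) / 2) * Real.exp ((∑ j ∈ T', ∑ k ∈ T', c' j * c' k * kingS2Inf0 (p' k - p' j)) / 2)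
        * (|∑ j ∈ T, ∑ k ∈ T', c j * c' k * kingS2Inf0 (p' k - p j)| * Real.exp |∑ j ∈ T, ∑ k ∈ T', c j * c' k * kingS2Inf0 (p' k - p j)|) := by
  rw [cov_exp_fieldSum0_eq hd, abs_mul, abs_mul, abs_of_pos (Real.exp_pos _), abs_of_pos (Real.exp_pos _)]
  exact mul_le_mul_of_nonneg_left (Literature.NumberTheory.Sieve.BombieriSieve.abs_exp_sub_one_le _) (by positivity)

/-! ## §2 The cross form under translations: power-law clustering -/

/-- `|Σ_{j,k}c_jc′_kS₂^{0}(p′_k + v − p_j)| ≤ Σ_{j,k}|c_j||c′_k|S₂^{0}(p′_k + v − p_j)`. [folklore] -/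
theorem abs_crossForm0_le (hd : 2 ≤ d) (T : Finset J) (p : J → Fin (d + 1) → ℤ) (c : J → ℝ) (T' : Finset J') (p' : J' → Fin (d + 1) → ℤ) (c' : J' → ℝ) (v : Fin (d + 1) → ℤ) :
    |∑ j ∈ T, ∑ k ∈ T', c j * c' k * kingS2Inf0 (p' k + v - p j)| ≤ ∑ j ∈ T, ∑ k ∈ T', |c j| * |c' k| * kingS2Inf0 (p' k + v - p j) := by
  refine (Finset.abs_sum_le_sum_abs _ _).trans (Finset.sum_le_sum fun j _ => (Finset.abs_sum_le_sum_abs _ _).trans (Finset.sum_le_sum fun k _ => ?_))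
  rw [abs_mul, abs_mul, abs_of_pos (kingS2Inf0_pos hd _)]

/-- ★★★ **POWER-LAW CLUSTERING OF THE CROSS FORM**: if every inter-block gap satisfies `R ≤ R₋(p′_k + v − p_j)` (`R > 0`), then
`|Σ_{j,k}c_jc′_kS₂^{0}(p′_k + v − p_j)| ≤ (Σ_{j,k}|c_j||c′_k|)·Γ((d−1)∕2)∕(4π^{(d+1)∕2}R^{d−1})` — the canonical rate `R^{−(d−1)}`. [cite: King1986, Thm 2.1 (2.22) p.654] -/
theorem abs_crossForm0_le_powerLaw (hd : 2 ≤ d) (T : Finset J) (p : J → Fin (d + 1) → ℤ) (c : J → ℝ) (T' : Finset J') (p' : J' → Fin (d + 1) → ℤ) (c' : J' → ℝ)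
    (v : Fin (d + 1) → ℤ) {R : ℝ} (hR : 0 < R) (hgap : ∀ j ∈ T, ∀ k ∈ T', R ≤ blockGap (p' k + v - p j)) :
    |∑ j ∈ T, ∑ k ∈ T', c j * c' k * kingS2Inf0 (p' k + v - p j)|
      ≤ (∑ j ∈ T, ∑ k ∈ T', |c j| * |c' k|) * (Real.Gamma (((d : ℝ) - 1) / 2) / (4 * Real.pi ^ (((d : ℝ) + 1) / 2) * R ^ (d - 1))) := by
  have hΓ : 0 < Real.Gamma (((d : ℝ) - 1) / 2) := Real.Gamma_pos_of_pos (by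
    have : (2 : ℝ) ≤ d := by exact_mod_cast hd
    linarith)
  have hπs : 0 < Real.pi ^ (((d : ℝ) + 1) / 2) := Real.rpow_pos_of_pos Real.pi_pos _
  refine (abs_crossForm0_le hd T p c T' p' c' v).trans ?_
  rw [Finset.sum_mul]
  refine Finset.sum_le_sum fun j hj => ?_
  rw [Finset.sum_mul]
  refine Finset.sum_le_sum fun k hk => mul_le_mul_of_nonneg_left ?_ (by positivity)
  have hg := hgap j hj k hk
  have hgap' : 0 < blockGap (p' k + v - p j) := hR.trans_le hg
  refine (kingS2Inf0_le_massless hd hgap').trans ?_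
  rw [div_le_div_iff_of_pos_left hΓ (by positivity) (by positivity)]
  exact mul_le_mul_of_nonneg_left (pow_le_pow_left₀ hR.le hg _) (by positivity)

/-- ★★ **POWER-LAW CLUSTERING OF `μ⁰_∞` ON EXPONENTIAL OBSERVABLES**: with `B = (Σ|c_j||c′_k|)Γ((d−1)∕2)∕(4π^{(d+1)∕2}R^{d−1})` and all gaps `≥ R > 0`,
`|∫e^{φ(f)}e^{φ(T_vg)}dμ⁰_∞ − ∫e^{φ(f)}dμ⁰_∞∫e^{φ(g)}dμ⁰_∞| ≤ e^{V_f∕2}e^{V_g∕2}·B·e^{B}`. [cite: King1986, Thm 2.1 (2.22) p.654, Thm 3.3 (3.6) p.655] -/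
theorem abs_cov_exp_shift0_le (hd : 2 ≤ d) (T : Finset J) (p : J → Fin (d + 1) → ℤ) (c : J → ℝ) (T' : Finset J') (p' : J' → Fin (d + 1) → ℤ) (c' : J' → ℝ)
    (v : Fin (d + 1) → ℤ) {R : ℝ} (hR : 0 < R) (hgap : ∀ j ∈ T, ∀ k ∈ T', R ≤ blockGap (p' k + v - p j)) :
    |(∫ ω, Real.exp (∑ j ∈ T, c j * ω (p j)) * Real.exp (∑ k ∈ T', c' k * ω (p' k + v)) ∂kingFieldInf0 d)
        - (∫ ω, Real.exp (∑ j ∈ T, c j * ω (p j)) ∂kingFieldInf0 d) * (∫ ω, Real.exp (∑ k ∈ T', c' k * ω (p' k)) ∂kingFieldInf0 d)|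
      ≤ Real.exp ((∑ j ∈ T, ∑ k ∈ T, c j * c k * kingS2Inf0 (p k - p j)) / 2) * Real.exp ((∑ j ∈ T', ∑ k ∈ T', c' j * c' k * kingS2Inf0 (p' k - p' j)) / 2)
        * (((∑ j ∈ T, ∑ k ∈ T', |c j| * |c' k|) * (Real.Gamma (((d : ℝ) - 1) / 2) / (4 * Real.pi ^ (((d : ℝ) + 1) / 2) * R ^ (d - 1))))
          * Real.exp ((∑ j ∈ T, ∑ k ∈ T', |c j| * |c' k|) * (Real.Gamma (((d : ℝ) - 1) / 2) / (4 * Real.pi ^ (((d : ℝ) + 1) / 2) * R ^ (d - 1))))) := by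
  have hshift : ∫ ω, Real.exp (∑ k ∈ T', c' k * ω (p' k)) ∂kingFieldInf0 d = ∫ ω, Real.exp (∑ k ∈ T', c' k * ω (p' k + v)) ∂kingFieldInf0 d := by
    rw [integral_exp_fieldSum0 hd, integral_exp_fieldSum0 hd]
    congr 2
    refine Finset.sum_congr rfl fun j _ => Finset.sum_congr rfl fun k _ => ?_
    rw [add_sub_add_right_eq_sub]
  rw [hshift]
  have h := abs_cov_exp_fieldSum0_le hd T p c T' (fun k => p' k + v) c'
  have hV' : ∑ j ∈ T', ∑ k ∈ T', c' j * c' k * kingS2Inf0 (p' k + v - (p' j + v)) = ∑ j ∈ T', ∑ k ∈ T', c' j * c' k * kingS2Inf0 (p' k - p' j) := by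
    refine Finset.sum_congr rfl fun j _ => Finset.sum_congr rfl fun k _ => ?_
    rw [add_sub_add_right_eq_sub]
  simp only [hV'] at h
  refine h.trans (mul_le_mul_of_nonneg_left ?_ (by positivity))
  have hC := abs_crossForm0_le_powerLaw hd T p c T' p' c' v hR hgap
  exact mul_le_mul hC (Real.exp_le_exp.mpr hC) (Real.exp_nonneg _) ((abs_nonneg _).trans hC)

/-! ## §3 Mixing -/

/-- The cross form `C_v → 0` along the cofinite filter of translations `v`. [folklore] -/
theorem tendsto_crossForm0_cofinite (hd : 2 ≤ d) (T : Finset J) (p : J → Fin (d + 1) → ℤ) (c : J → ℝ) (T' : Finset J') (p' : J' → Fin (d + 1) → ℤ) (c' : J' → ℝ) :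
    Tendsto (fun v : Fin (d + 1) → ℤ => ∑ j ∈ T, ∑ k ∈ T', c j * c' k * kingS2Inf0 (p' k + v - p j)) cofinite (𝓝 0) := by
  have h0 : (0 : ℝ) = ∑ j ∈ T, ∑ k ∈ T', c j * c' k * 0 := by simp
  rw [h0]
  refine tendsto_finsetSum _ fun j _ => tendsto_finsetSum _ fun k _ => ((tendsto_kingS2Inf0_cofinite hd).comp ?_).const_mul _
  have hinj : Function.Injective fun v : Fin (d + 1) → ℤ => p' k + v - p j := fun v w h => by simpa using h
  exact hinj.tendsto_cofinite

/-- ★★ **MIXING OF THE MASSLESS BLOCK FIELD**: `∫e^{φ(f)}e^{φ(T_vg)}dμ⁰_∞ → ∫e^{φ(f)}dμ⁰_∞·∫e^{φ(g)}dμ⁰_∞` as the translation `v → ∞`. [cite: King1986, Thm 2.1 (2.22) p.654] -/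
theorem tendsto_cov_exp_shift0 (hd : 2 ≤ d) (T : Finset J) (p : J → Fin (d + 1) → ℤ) (c : J → ℝ) (T' : Finset J') (p' : J' → Fin (d + 1) → ℤ) (c' : J' → ℝ) :
    Tendsto (fun v : Fin (d + 1) → ℤ => ∫ ω, Real.exp (∑ j ∈ T, c j * ω (p j)) * Real.exp (∑ k ∈ T', c' k * ω (p' k + v)) ∂kingFieldInf0 d) cofinite
      (𝓝 ((∫ ω, Real.exp (∑ j ∈ T, c j * ω (p j)) ∂kingFieldInf0 d) * (∫ ω, Real.exp (∑ k ∈ T', c' k * ω (p' k)) ∂kingFieldInf0 d))) := by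
  -- closed forms
  set V : ℝ := ∑ j ∈ T, ∑ k ∈ T, c j * c k * kingS2Inf0 (p k - p j) with hV
  set V' : ℝ := ∑ j ∈ T', ∑ k ∈ T', c' j * c' k * kingS2Inf0 (p' k - p' j) with hV'
  have hform : ∀ v : Fin (d + 1) → ℤ, ∫ ω, Real.exp (∑ j ∈ T, c j * ω (p j)) * Real.exp (∑ k ∈ T', c' k * ω (p' k + v)) ∂kingFieldInf0 d
      = Real.exp (V / 2 + V' / 2 + ∑ j ∈ T, ∑ k ∈ T', c j * c' k * kingS2Inf0 (p' k + v - p j)) := by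
    intro v
    rw [integral_exp_mul_exp_fieldSum0 hd T p c T' (fun k => p' k + v) c']
    have e : ∑ j ∈ T', ∑ k ∈ T', c' j * c' k * kingS2Inf0 (p' k + v - (p' j + v)) = V' :=
      Finset.sum_congr rfl fun j _ => Finset.sum_congr rfl fun k _ => by rw [add_sub_add_right_eq_sub]
    rw [e]
  have hlim : (∫ ω, Real.exp (∑ j ∈ T, c j * ω (p j)) ∂kingFieldInf0 d) * (∫ ω, Real.exp (∑ k ∈ T', c' k * ω (p' k)) ∂kingFieldInf0 d)
      = Real.exp (V / 2 + V' / 2 + 0) := by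
    rw [integral_exp_fieldSum0 hd, integral_exp_fieldSum0 hd, ← Real.exp_add, add_zero]
  simp_rw [hform]
  rw [hlim]
  exact (Real.continuous_exp.tendsto _).comp (tendsto_const_nhds.add (tendsto_crossForm0_cofinite hd T p c T' p' c'))

end Summit.QuantumFields.YangMills.BalabanUVNodes.N15KingModelRung.InfiniteVolume
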